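import Summits.BirchSwinnertonDyer.BirchSwinnertonDyer.Theorems.GenusKolyvaginAtTwoOffCutResidualAtTwoRSocleSelectionHeegnerLift
import Summits.BirchSwinnertonDyer.BirchSwinnertonDyer.Theorems.GenusKolyvaginAtTwoOffCutResidualAtTwoRSocleSelectionHeegnerSocleUnramSOC
import Summits.BirchSwinnertonDyer.BirchSwinnertonDyer.Theorems.GenusKolyvaginAtTwoOffCutResidualAtTwoRSocleSelectionRealTrivialClass
import HarnessLib

/-!
# Route `GenusKolyvaginAtTwo`, residual `OffCutResidualAtTwoR` (stmt-BirchSwinnertonDyer-31767), LINE 27 «socle_selection» —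
# STUB S2 `stub_shallowFrameSocle` = (HL) ∧ (SOC) ∧ (RTV) VERBATIM, as ONE tree theorem

Seat `bsd-line-gk2-p4` g30 (cell `bsd-f1-sign2`), WIDTH-5 attach on route `GenusKolyvaginAtTwo` rev 59.  `--supports stmt-BirchSwinnertonDyer-31767 --as
helper`.  THEOREMS ONLY (no definition, no named fact, no `sorry`); standard axioms.  **BSD is NOT proved by this file; `OffCutResidualAtTwoR` is NOT
proved; no item is closed** (LINE 27 keeps the stubs S6L′ and S7).  PRINT used: `MultPublishedInputsAtTwo` (ranks `0 + 1`), as in the conjuncts.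

* **`shallowFrameSocle`** — the statement of the skeleton's composite `stub_shallowFrameSocle` (LINE 27 v2.0 S2) VERBATIM, assembled exactly as the
  skeleton does from the three tree theorems: (HL) `SocleSelection.heegnerLift` (gk2-p4 g30), (SOC) `SocleSelection.sharedSocle_of_realTrivialSocle`
  (LEAD gk2-p1 g25), (RTV) `SocleSelection.realTrivial_of_natCard_selmerGroup_two_eq_four` (LEAD gk2-p1 g24, p775515).  The pen may replace
  `stub_shallowFrameSocle` (and `stub_heegnerLift`, `stub_socleSharing`) by these names.
BSD is NOT proved by any of this.

References: [LawsonWuthrich2016] §7.1; [Kramer1981] Thm. 1, §2 Prop. 6; [GrossLMS1991] §4, §9; [McCallumLMS1991] §3–§5; [MazurRubin2007] §3.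
-/

set_option autoImplicit false
-- the Theorems namespace of this sub repeats the summit name by design (D-0017 nested layout)
set_option linter.dupNamespace false

noncomputable section

open scoped Classical

namespace Summit.BirchSwinnertonDyer.BirchSwinnertonDyer.Theorems.GenusExact.PlusDescent.SocleSelection

open WeierstrassCurve NumberField IsDedekindDomain Field
open Literature.NumberTheory.EllipticCurves Literature.NumberTheory.GaloisRepresentations
open Summit.BirchSwinnertonDyer.BirchSwinnertonDyer.Theses.GenusKolyvaginAtTwo (MultPublishedInputsAtTwo)
open Literature.NumberTheory.EllipticCurves.ModularForms Literature.NumberTheory.EllipticCurves.KolyvaginCocycle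

/-- **LINE 27 STUB S2 — (HL) ∧ (SOC) ∧ (RTV) on the shallow `Δ > 0` Heegner frame** (statement of the skeleton's `stub_shallowFrameSocle` VERBATIM):
(HL) no non-zero multiple of the level-raised Heegner class is phantom (`heegnerLift`); (SOC) for `M ≥ M₀ + 1` every `Sel_(2^M)(E/ℚ)`-class whose socle
is a real-trivial level-`2` class shares its socle over `K` with `ι c_M(1)` (`sharedSocle_of_realTrivialSocle`); (RTV) a non-zero real-trivial class of
`Sel₂(E)` exists (`realTrivial_of_natCard_selmerGroup_two_eq_four`).  BSD is NOT proved by this; `OffCutResidualAtTwoR` is NOT proved.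
[cite: LawsonWuthrich2016, §7.1] [cite: Kramer1981, Thm. 1, §2 Prop. 6] [cite: GrossLMS1991, §4 (4.4), §9] [cite: McCallumLMS1991, §4 Lemma 4.6, §5 Lemma 5.1] -/
theorem shallowFrameSocle :
    ∀ (W : WeierstrassCurve ℚ) [W.IsElliptic] [W.IsGloballyMinimal] [NeZero (W.conductorNorm ℤ)],
      W.analyticRank = 0 → (∀ n : ℕ, 0 < n → W.HasSurjectiveModNGaloisRep ((2 : ℤ) ^ n)) → Odd W.tamagawaProduct → 0 < W.Δ →
      ∀ (K : Type) [Field K] [NumberField K], IsImaginaryQuadratic K → Odd (NumberField.discr K) → NumberField.discr K ≠ -3 →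
        SatisfiesHeegnerHypothesis (W.conductorNorm ℤ) K →
        ¬ IsSquare ((NumberField.discr K : ℚ) * -|W.Δ|) → ¬ IsSquare ((NumberField.discr K : ℚ) * (-(2 * |W.Δ|))) →
      ∀ (Dt : ModularParametrizationData W (W.conductorNorm ℤ)),
        (∀ z ∈ Dt.L.lattice, ∃ w ∈ periodLattice Dt.f, z = (Dt.c : ℂ) * w) → Odd Dt.c →
      ∀ (β : ℤ) (ι : K →+* ℂ) (d₁ : KolyvaginHeegnerData Dt β ι 1), ¬ IsOfFinAddOrder d₁.derivedPoint →
      ∀ (M₀ : ℕ), (∃ Q : (W.baseChange (ringClassField K ι 1)).toAffine.Point, ((2 ^ M₀ : ℕ) : ℤ) • Q = d₁.derivedPoint) →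
        (¬ ∃ Q : (W.baseChange (ringClassField K ι 1)).toAffine.Point, ((2 ^ (M₀ + 1) : ℕ) : ℤ) • Q = d₁.derivedPoint) →
      ∀ (Wd : WeierstrassCurve ℚ) [Wd.IsElliptic] [Wd.IsGloballyMinimal],
        (∃ C : WeierstrassCurve.VariableChange ℚ, C • W.quadraticTwist (NumberField.discr K : ℚ) = Wd) →
        Wd.analyticRank = 1 → Nat.card (Wd.selmerGroup 2) = 2 → padicValNat 2 Wd.tamagawaProduct = 0 →
      Nat.card (W.selmerGroup 2) = 4 → MultPublishedInputsAtTwo →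
      -- (HL)
      (∀ (M : ℕ) (hdvd : ((2 ^ M : ℕ) : ℤ) ∣ ((2 ^ (M + 1) : ℕ) : ℤ)) (c : ℤ),
          (∀ ρ ∈ torsionFixing (W.baseChange K) ((2 ^ (M + 1) : ℕ) : ℤ), h1Eval (W.baseChange K) ((2 ^ (M + 1) : ℕ) : ℤ)
              (c • torsionH1OfDvd (W.baseChange K) hdvd (d₁.kolyvaginClass Nat.prime_two M)) ρ = 0) →
          c • torsionH1OfDvd (W.baseChange K) hdvd (d₁.kolyvaginClass Nat.prime_two M) = 0) ∧
      -- (SOC)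
      (∀ (M : ℕ), M₀ + 1 ≤ M → ∀ (s₀ : galH1Torsion W ((2 ^ M : ℕ) : ℤ)), s₀ ∈ selmerGroup W ((2 ^ M : ℕ) : ℤ) →
          (∃ c : galH1Torsion W 2, c ≠ 0 ∧ (∀ w : InfinitePlace ℚ, c ∈ W.torsionLocalKer w.Completion 2) ∧
            ∀ hdvd₁ : (2 : ℤ) ∣ ((2 ^ M : ℕ) : ℤ), torsionH1OfDvd W hdvd₁ c ∈ AddSubgroup.zmultiples s₀) →
          ∀ (hdvd : ((2 ^ M : ℕ) : ℤ) ∣ ((2 ^ (M + 1) : ℕ) : ℤ)), ∃ i j : ℕ,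
            ((2 ^ i : ℕ) : ℤ) • torsionH1OfDvd (W.baseChange K) hdvd (resTorsion W K ((2 ^ M : ℕ) : ℤ) s₀) =
              ((2 ^ j : ℕ) : ℤ) • torsionH1OfDvd (W.baseChange K) hdvd (d₁.kolyvaginClass Nat.prime_two M) ∧
            ((2 ^ j : ℕ) : ℤ) • torsionH1OfDvd (W.baseChange K) hdvd (d₁.kolyvaginClass Nat.prime_two M) ≠ 0 ∧
            (2 : ℤ) • (((2 ^ j : ℕ) : ℤ) • torsionH1OfDvd (W.baseChange K) hdvd (d₁.kolyvaginClass Nat.prime_two M)) = 0) ∧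
      -- (RTV)
      (∃ v ∈ W.selmerGroup 2, v ≠ 0 ∧ ∀ w : InfinitePlace ℚ, v ∈ W.torsionLocalKer w.Completion 2) := by
  intro W _ _ _ hr0 hρ hT hpos K _ _ hIQ hodd h3 hHe hsq1 hsq2 Dt hoptDt hc β ι d₁ hy M₀ hdiv hndiv Wd _ _ hWd hrd hSel hTam h4 hGZK
  exact ⟨heegnerLift W hr0 hρ hT hpos K hIQ hodd h3 hHe hsq1 hsq2 Dt hoptDt hc β ι d₁ hy M₀ hdiv hndiv Wd hWd hrd hSel hTam h4 hGZK,
    sharedSocle_of_realTrivialSocle W hr0 hρ hT hpos K hIQ hodd h3 hHe hsq1 hsq2 Dt hoptDt hc β ι d₁ hy M₀ hdiv hndiv Wd hWd hrd hSel hTam h4 hGZK,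
    realTrivial_of_natCard_selmerGroup_two_eq_four W hpos h4⟩

end Summit.BirchSwinnertonDyer.BirchSwinnertonDyer.Theorems.GenusExact.PlusDescent.SocleSelection

end
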